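import Mathlib
import Summits.NavierStokesRegularity.NavierStokesRegularity.Theorems.FilamentSkeletonRssAreaLawSlavingLocalUniqueArm

/-!
# Area-law slaving, part 13 — TWO-SIDED uniqueness of the regular core area on the real trace (interval hypotheses)
# (`FilamentSkeletonRss`, child crux `TangentSkeletonNearStraight`, stmt-NavierStokesRegularity-28295, line
# `child_tangent_analytic_strip`, ∃-side of the registered stub `stub_analyticClosing`: the `StadiumAnalyticArea` conjunct)

Parts 11–12 (`areaLaw_unique_window_right_local`, `areaLaw_unique_arm_right_local`) give uniqueness of the regular solution of the
area law `w·A′ = (3/2 − w′)·A + 4` on a core window `[c, c + r]` and along a right arm, from hypotheses on those intervals only.  This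
file assembles them into the identification statement the `StadiumAnalyticArea` conjunct needs: on an open interval `(a, b) ∋ c` (the
real trace of the stadium), two differentiable solutions of the area law against a slip `w` with `w(c) = 0`, no other zero, `w′(c) = d > 3/2`,
`|w′(s) − d| ≤ K₂|s − c|` and `|w′| ≤ Λ`, COINCIDE on `(a, b)` — to the right by window + arm (the window length
`r = min((b − c)/2, (d − 3/2)/(K₂ + 1))` makes `w′ ≥ 3/2` on the window; positivity of `w` on `(c, b)` by the intermediate value
theorem; the arm floor by compactness), to the left by the reflection `s ↦ 2c − s`, `w ↦ −w(2c − ·)`, which preserves the law.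

* `areaLaw_trace_unique_right` — coincidence on `[c, b)`;
* `areaLaw_reflect_local` — the reflected triple satisfies the same hypotheses (pointwise form of part 3's `areaLaw_reflect`);
* `areaLaw_trace_unique` — coincidence on `(a, b)`.

HONEST FRAMING: elementary ODE analysis serving a HYPOTHETICAL filament skeleton on the NEGATIVE side of a MODEL route; no registered
stub is closed by this file and nothing here bears on Navier–Stokes regularity or blow-up.  `--supports stmt-NavierStokesRegularity-28295`.
-/

set_option linter.dupNamespace false

noncomputable section

namespace Summit.NavierStokesRegularity.NavierStokesRegularity.Theorems.AreaLawSlaving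

open Set Real

/-- **Coincidence to the right of the zero.**  On the open interval `(a, b) ∋ c`: `w, A₁, A₂` differentiable, both area laws,
`w c = 0`, `w ≠ 0` off `c`, `w′(c) = d > 3/2`, `|w′(s) − d| ≤ K₂|s − c|` (`K₂ ≥ 0`), `|w′| ≤ Λ`.  Then `A₁ = A₂` on `[c, b)`.
[folklore] -/
theorem areaLaw_trace_unique_right {w A₁ A₂ : ℝ → ℝ} {a b c d K₂ Λ : ℝ} (hc : c ∈ Ioo a b)
    (hw : ∀ s ∈ Ioo a b, DifferentiableAt ℝ w s) (hA₁ : ∀ s ∈ Ioo a b, DifferentiableAt ℝ A₁ s)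
    (hA₂ : ∀ s ∈ Ioo a b, DifferentiableAt ℝ A₂ s)
    (h₁ : ∀ s ∈ Ioo a b, w s * deriv A₁ s = (3 / 2 - deriv w s) * A₁ s + 4)
    (h₂ : ∀ s ∈ Ioo a b, w s * deriv A₂ s = (3 / 2 - deriv w s) * A₂ s + 4)
    (hwc : w c = 0) (hwz : ∀ s ∈ Ioo a b, s ≠ c → w s ≠ 0) (hd : 3 / 2 < d) (hK₂ : 0 ≤ K₂)
    (hlip : ∀ s ∈ Ioo a b, |deriv w s - d| ≤ K₂ * |s - c|) (hΛ : ∀ s ∈ Ioo a b, |deriv w s| ≤ Λ)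
    {x : ℝ} (hxc : c ≤ x) (hxb : x < b) : A₁ x = A₂ x := by
  -- the window length
  obtain ⟨r, hr⟩ : ∃ r : ℝ, r = min ((b - c) / 2) ((d - 3 / 2) / (K₂ + 1)) := ⟨_, rfl⟩
  have hbc : 0 < b - c := by linarith [hc.2]
  have hr_pos : 0 < r := by
    rw [hr]; exact lt_min (by linarith) (div_pos (by linarith) (by linarith))
  have hr_b : c + r < b := by
    have : r ≤ (b - c) / 2 := by rw [hr]; exact min_le_left _ _
    linarith
  have hK₂r : K₂ * r ≤ d - 3 / 2 := by
    have h1 : r ≤ (d - 3 / 2) / (K₂ + 1) := by rw [hr]; exact min_le_right _ _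
    have h2 : K₂ * r ≤ (K₂ + 1) * r := by nlinarith
    calc K₂ * r ≤ (K₂ + 1) * r := h2
      _ ≤ (K₂ + 1) * ((d - 3 / 2) / (K₂ + 1)) := mul_le_mul_of_nonneg_left h1 (by linarith)
      _ = d - 3 / 2 := by field_simp
  -- sub-intervals of `(a, b)`
  have hIcc_sub : ∀ {s₀ s₁ : ℝ}, a < s₀ → s₁ < b → Icc s₀ s₁ ⊆ Ioo a b :=
    fun h0 h1 s hs => ⟨lt_of_lt_of_le h0 hs.1, lt_of_le_of_lt hs.2 h1⟩
  have hwin_sub : Icc c (c + r) ⊆ Ioo a b := hIcc_sub hc.1 hr_b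
  -- continuity of `w` on `(a, b)`
  have hwcont : ∀ {s₀ s₁ : ℝ}, a < s₀ → s₁ < b → ContinuousOn w (Icc s₀ s₁) :=
    fun h0 h1 s hs => (hw s (hIcc_sub h0 h1 hs)).continuousAt.continuousWithinAt
  -- (1) the window condition `(3/2)(s − c) ≤ w s` on `[c, c + r]` (there `w′ ≥ d − K₂ r ≥ 3/2`)
  have hwin : ∀ s ∈ Icc c (c + r), 3 / 2 * (s - c) ≤ w s := by
    intro s hs
    have hD : Convex ℝ (Icc c (c + r)) := convex_Icc _ _
    have hcont : ContinuousOn w (Icc c (c + r)) := hwcont hc.1 hr_b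
    have hdiff : DifferentiableOn ℝ w (interior (Icc c (c + r))) := by
      rw [interior_Icc]; exact fun σ hσ => (hw σ (hwin_sub (Ioo_subset_Icc_self hσ))).differentiableWithinAt
    have hge : ∀ σ ∈ interior (Icc c (c + r)), (3 / 2 : ℝ) ≤ deriv w σ := by
      rw [interior_Icc]; intro σ hσ
      have hl := hlip σ (hwin_sub (Ioo_subset_Icc_self hσ))
      rw [abs_of_pos (by linarith [hσ.1] : 0 < σ - c)] at hl
      have := (abs_le.1 hl).1
      nlinarith [hσ.2, hK₂]
    have h := hD.mul_sub_le_image_sub_of_le_deriv hcont hdiff hge c (left_mem_Icc.2 (by linarith)) s hs hs.1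
    rw [hwc, sub_zero] at h
    exact h
  -- (2) coincidence on the window
  have hwindow : ∀ τ ∈ Icc c (c + r), A₁ τ = A₂ τ := fun τ hτ =>
    areaLaw_unique_window_right_local (fun s hs => hw s (hwin_sub hs)) (fun s hs => hA₁ s (hwin_sub hs))
      (fun s hs => hA₂ s (hwin_sub hs)) (fun s hs => h₁ s (hwin_sub hs)) (fun s hs => h₂ s (hwin_sub hs)) hwc
      (fun s hs => hΛ s (hwin_sub hs)) hwin hτ.1 hτ.2
  by_cases hxr : x ≤ c + r
  · exact hwindow x ⟨hxc, hxr⟩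
  push Not at hxr
  -- (3) positivity of `w` on `(c, b)`: on the window by (1), beyond by the intermediate value theorem and `w ≠ 0`
  have hpos : ∀ s, c < s → s < b → 0 < w s := by
    intro s hsc hsb
    by_cases hsr : s ≤ c + r
    · exact lt_of_lt_of_le (by linarith) (hwin s ⟨hsc.le, hsr⟩)
    · push Not at hsr
      by_contra hneg
      push Not at hneg
      -- `w (c + r) > 0 ≥ w s`: a zero in `[c + r, s]`, impossible
      have hwr : 0 < w (c + r) := lt_of_lt_of_le (by linarith) (hwin (c + r) ⟨by linarith, le_rfl⟩)
      have hcont : ContinuousOn w (Icc (c + r) s) := hwcont (by linarith [hc.1]) hsb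
      have hivt := intermediate_value_Icc' hsr.le hcont
      have h0mem : (0 : ℝ) ∈ Icc (w s) (w (c + r)) := ⟨hneg, hwr.le⟩
      obtain ⟨ξ, hξ, hξ0⟩ := hivt h0mem
      exact hwz ξ (hIcc_sub (by linarith [hc.1]) hsb hξ) (by linarith [hξ.1]) hξ0
  -- (4) the arm `[c + r, x]`: slip floor by compactness, then part 12
  have harm_sub : Icc (c + r) x ⊆ Ioo a b := hIcc_sub (by linarith [hc.1]) hxb
  have hcontarm : ContinuousOn w (Icc (c + r) x) := hwcont (by linarith [hc.1]) hxb
  obtain ⟨ξ₀, hξ₀, hmin⟩ := (isCompact_Icc : IsCompact (Icc (c + r) x)).exists_isMinOn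
    (nonempty_Icc.2 hxr.le) hcontarm
  have hwmin : 0 < w ξ₀ := hpos ξ₀ (by linarith [hξ₀.1]) (lt_of_le_of_lt hξ₀.2 hxb)
  exact areaLaw_unique_arm_right_local (fun s hs => hw s (harm_sub hs)) (fun s hs => hA₁ s (harm_sub hs))
    (fun s hs => hA₂ s (harm_sub hs)) (fun s hs => h₁ s (harm_sub hs)) (fun s hs => h₂ s (harm_sub hs)) hwmin
    (fun s hs => hmin hs) (hwindow (c + r) ⟨by linarith, le_rfl⟩) hxr.le le_rfl

/-- **Reflection through the zero preserves the area law.**  With `σ = 2c − s`: `w̃(σ) = −w(2c − σ)`, `Ã(σ) = A(2c − σ)` satisfy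
`w̃·Ã′ = (3/2 − w̃′)·Ã + 4` wherever `w, A` are differentiable and satisfy the law at `2c − σ`; `w̃′(σ) = w′(2c − σ)`. [folklore] -/
theorem areaLaw_reflect_local {w A : ℝ → ℝ} {c σ : ℝ} (hw : DifferentiableAt ℝ w (2 * c - σ)) (hA : DifferentiableAt ℝ A (2 * c - σ))
    (h : w (2 * c - σ) * deriv A (2 * c - σ) = (3 / 2 - deriv w (2 * c - σ)) * A (2 * c - σ) + 4) :
    DifferentiableAt ℝ (fun s => -w (2 * c - s)) σ ∧ DifferentiableAt ℝ (fun s => A (2 * c - s)) σ ∧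
      deriv (fun s => -w (2 * c - s)) σ = deriv w (2 * c - σ) ∧
      deriv (fun s => A (2 * c - s)) σ = -deriv A (2 * c - σ) ∧
      (-w (2 * c - σ)) * deriv (fun s => A (2 * c - s)) σ =
        (3 / 2 - deriv (fun s => -w (2 * c - s)) σ) * A (2 * c - σ) + 4 := by
  have hφ : HasDerivAt (fun s : ℝ => 2 * c - s) (-1) σ := by
    simpa using (hasDerivAt_id σ).const_sub (2 * c)
  have hwr : HasDerivAt (fun s => -w (2 * c - s)) (deriv w (2 * c - σ)) σ := by
    have h1 : HasDerivAt (fun s => w (2 * c - s)) (deriv w (2 * c - σ) * (-1)) σ := hw.hasDerivAt.comp σ hφ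
    have h2 := h1.neg
    exact h2.congr_deriv (by ring)
  have hAr : HasDerivAt (fun s => A (2 * c - s)) (-deriv A (2 * c - σ)) σ := by
    have h1 : HasDerivAt (fun s => A (2 * c - s)) (deriv A (2 * c - σ) * (-1)) σ := hA.hasDerivAt.comp σ hφ
    exact h1.congr_deriv (by ring)
  refine ⟨hwr.differentiableAt, hAr.differentiableAt, hwr.deriv, hAr.deriv, ?_⟩
  rw [hwr.deriv, hAr.deriv]
  linear_combination h

/-- **Two-sided coincidence on the trace interval.**  Hypotheses of `areaLaw_trace_unique_right` on `(a, b) ∋ c` (note that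
`|w′(s) − d| ≤ K₂|s − c|` at `s = c` forces `w′(c) = d`); then `A₁ = A₂` on `(a, b)`. [folklore] -/
theorem areaLaw_trace_unique {w A₁ A₂ : ℝ → ℝ} {a b c d K₂ Λ : ℝ} (hc : c ∈ Ioo a b)
    (hw : ∀ s ∈ Ioo a b, DifferentiableAt ℝ w s) (hA₁ : ∀ s ∈ Ioo a b, DifferentiableAt ℝ A₁ s)
    (hA₂ : ∀ s ∈ Ioo a b, DifferentiableAt ℝ A₂ s)
    (h₁ : ∀ s ∈ Ioo a b, w s * deriv A₁ s = (3 / 2 - deriv w s) * A₁ s + 4)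
    (h₂ : ∀ s ∈ Ioo a b, w s * deriv A₂ s = (3 / 2 - deriv w s) * A₂ s + 4)
    (hwc : w c = 0) (hwz : ∀ s ∈ Ioo a b, s ≠ c → w s ≠ 0) (hd : 3 / 2 < d) (hK₂ : 0 ≤ K₂)
    (hlip : ∀ s ∈ Ioo a b, |deriv w s - d| ≤ K₂ * |s - c|)
    (hΛ : ∀ s ∈ Ioo a b, |deriv w s| ≤ Λ) {x : ℝ} (hx : x ∈ Ioo a b) : A₁ x = A₂ x := by
  rcases le_or_gt c x with hcx | hxc
  · exact areaLaw_trace_unique_right hc hw hA₁ hA₂ h₁ h₂ hwc hwz hd hK₂ hlip hΛ hcx hx.2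
  · -- reflect through `c`: the interval `(2c − b, 2c − a) ∋ c`, the point `2c − x ≥ c`
    have hmem : ∀ {σ : ℝ}, σ ∈ Ioo (2 * c - b) (2 * c - a) → 2 * c - σ ∈ Ioo a b :=
      fun hσ => ⟨by linarith [hσ.2], by linarith [hσ.1]⟩
    have hR := fun σ (hσ : σ ∈ Ioo (2 * c - b) (2 * c - a)) =>
      areaLaw_reflect_local (hw _ (hmem hσ)) (hA₁ _ (hmem hσ)) (h₁ _ (hmem hσ))
    have hR₂ := fun σ (hσ : σ ∈ Ioo (2 * c - b) (2 * c - a)) =>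
      areaLaw_reflect_local (hw _ (hmem hσ)) (hA₂ _ (hmem hσ)) (h₂ _ (hmem hσ))
    have hc' : c ∈ Ioo (2 * c - b) (2 * c - a) := ⟨by linarith [hc.2], by linarith [hc.1]⟩
    have key := areaLaw_trace_unique_right (w := fun s => -w (2 * c - s)) (A₁ := fun s => A₁ (2 * c - s))
      (A₂ := fun s => A₂ (2 * c - s)) (a := 2 * c - b) (b := 2 * c - a) (c := c) (d := d) (K₂ := K₂) (Λ := Λ) hc'
      (fun σ hσ => (hR σ hσ).1) (fun σ hσ => (hR σ hσ).2.1) (fun σ hσ => (hR₂ σ hσ).2.1)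
      (fun σ hσ => (hR σ hσ).2.2.2.2) (fun σ hσ => (hR₂ σ hσ).2.2.2.2)
      (by show -w (2 * c - c) = 0; rw [show 2 * c - c = c by ring, hwc, neg_zero])
      (fun σ hσ hσc => by
        show -w (2 * c - σ) ≠ 0
        rw [neg_ne_zero]
        exact hwz _ (hmem hσ) (fun h => hσc (by linarith)))
      hd hK₂
      (fun σ hσ => by
        rw [(hR σ hσ).2.2.1]
        have := hlip _ (hmem hσ)
        rwa [show 2 * c - σ - c = -(σ - c) by ring, abs_neg] at this)
      (fun σ hσ => by rw [(hR σ hσ).2.2.1]; exact hΛ _ (hmem hσ))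
      (x := 2 * c - x) (by linarith) (by linarith [hx.1])
    simpa using key

end Summit.NavierStokesRegularity.NavierStokesRegularity.Theorems.AreaLawSlaving
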